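import Summits.CriticalPhenomena.PercolationContinuityZ3.Theorems.Transplant.SubgraphLocModCycleA
import HarnessLib

/-!
# Routes from cycle data, III: UP-CLOSED regions suffice — the local modification from TAIL conditions instead of the class dichotomy

builds on p205010 (kernel theorem, internal audit signed; external expert review pending) — nothing in this file uses p205010; nothing
here is a claim about any open node.
Lane `prim-bschramm`, seat `prim-bschramm-p4` gen 15 (PART C3 of `P4-GENERAL.md`, §37: Φ2 for EVERY frames-only skeleton).  Helper file
(`--supports stmt-CriticalPhenomena-4575 --as helper`).  Pure graph theory; sequel of `SubgraphLocModCycleA`.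

File II (`CycleKit.exists_routeData_of_pivotal`) produces the Aizenman–Grimmett / Menshikov local modification at a pivotal subgraph edge
`{x, y}` carrying a cycle kit `x —A→ p —M→ q —B→ y → x` when EACH COLUMN IS ENTIRELY INSIDE OR ENTIRELY OUTSIDE the region `Ω` — which is
why the cylinder method so far needed a partition of the big cylinder into finite CLASSES (column classes, escape data).  This file shows that
much less is needed, namely only what an UP-CLOSED region gives:
* the column of an endpoint lies in `Ω` when that endpoint does (`hAx`, `hBy`);
* the part of a column ABOVE any of its vertices lying in `Ω` lies in `Ω` (`hAtail`, `hBtail`).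
THEOREM `CycleKit.exists_routeData_of_pivotal_of_tails`.  The one new case (`routeData_of_mem_B_of_notMem`): the first cycle vertex `u` seen
from the root lies on the column of `y` while `y ∉ Ω` — route = up that column from `u` (inside `Ω` by the tail condition), the enhancement
edge of `M` at `q`, back through `M` and down the column of `x` to `x`, closing edge to the target `y ∉ Ω`.
Consumer: `PlanarSkeletonFrmRayStrict` (regions = finite hulls closed under the two outward step maps; columns = rays).
[cite: AizenmanGrimmett1991, §2 (essential enhancements)] [cite: BalisterBollobasRiordan2014, §"bond percolation" p. 13]
[cite: Menshikov1987, Thm (graph and subgraph)]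
-/

namespace Summit.CriticalPhenomena.PercolationContinuityZ3.Theorems.Transplant

namespace SubLoc

open SimpleGraph Walk

variable {V : Type} [DecidableEq V] {H : SimpleGraph V}

/-- Tail conditions transport along an equality of walks. [folklore] -/
theorem tails_of_eq {a b : V} {P Q : H.Walk a b} (h : P = Q) {Ω : Set V}
    (hP : ∀ (u : V) (hu : u ∈ P.support), u ∈ Ω → ∀ w ∈ (P.dropUntil u hu).support, w ∈ Ω) :
    ∀ (u : V) (hu : u ∈ Q.support), u ∈ Ω → ∀ w ∈ (Q.dropUntil u hu).support, w ∈ Ω := by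
  subst h; exact hP

namespace CycleKit

variable {E' : Set (Sym2 V)} {x y : V} (K : CycleKit H E' x y)

/-- **Case `u ∈ B`, `y ∉ Ω` (NEW).**  The route climbs the column of `y` from `u` to `q` (inside `Ω` by the tail condition), uses the
enhancement edge of `M` at `q`, runs back through `M`, down `A` to `x` and across the closing edge to the target `y ∉ Ω`.
[cite: BalisterBollobasRiordan2014, §"bond percolation" p. 13] -/
theorem routeData_of_mem_B_of_notMem {ωe : Set (Sym2 V)} {Ω : Set V} {o u : V}
    (huB : u ∈ K.B.reverse.support) (hyΩ : y ∉ Ω)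
    (π : (og H ωe).Walk o u) (hπ : ∀ w ∈ π.support, w ∈ K.Z → w = u)
    (hR : ∀ w ∈ (K.B.reverse.dropUntil u huB).support, w ∈ Ω) :
    ∃ D : RouteData H ωe Ω K.Z o, s(D.a, D.b) ∈ E' := by
  have huΩ : u ∈ Ω := hR u (Walk.start_mem_support _)
  have hyu : u ≠ y := fun h => hyΩ (h ▸ huΩ)
  have huB' : u ∈ K.B.support := by simpa using huB
  -- the last edge of `M` (the first of `M.reverse`)
  obtain ⟨mk, hqm, M'', hM''⟩ := exists_eq_cons K.M.reverse K.hpq.symm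
  have hMq : M''.IsPath ∧ K.q ∉ M''.support := by
    have h := K.hM.reverse; rw [hM'', cons_isPath_iff] at h; exact h
  have hM''sub : ∀ w ∈ M''.support, w ∈ K.M.support := fun w hw => by
    have : w ∈ K.M.reverse.support := by rw [hM'', support_cons]; exact List.mem_cons_of_mem _ hw
    simpa using this
  have hf' : s(K.q, mk) ∈ E' := K.hME _ (by
    have : s(K.q, mk) ∈ K.M.reverse.edges := by rw [hM'', edges_cons]; exact List.mem_cons_self
    simpa using this)
  have hR₁B : ∀ w ∈ (K.B.reverse.dropUntil u huB).support, w ∈ K.B.support := fun w hw => by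
    have := support_dropUntil_subset_support _ _ hw
    simpa using this
  have hyR₁ : y ∉ (K.B.reverse.dropUntil u huB).support := start_not_mem_dropUntil K.hB.reverse huB hyu
  refine ⟨⟨u, K.q, mk, y, K.B.reverse.dropUntil u huB, hqm,
    M''.append (K.A.reverse.append (Walk.cons K.hyx.symm Walk.nil)), ?_, ?_, ?_, hR, π, hπ, Or.inl hyΩ⟩, hf'⟩
  · intro w h1 h2
    rw [mem_support_append_iff, mem_support_append_iff, support_reverse, List.mem_reverse, support_cons, support_nil,
      List.mem_cons, List.mem_singleton] at h2
    rcases h2 with h2 | h2 | rfl | rfl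
    · exact hMq.2 ((K.hMB w (hM''sub w h2) (hR₁B w h1)) ▸ h2)
    · exact K.hAB w h2 (hR₁B w h1)
    · exact K.hAB _ K.A.start_mem_support (hR₁B _ h1)
    · exact hyR₁ h1
  · exact fun w hw => Or.inr (Or.inr (hR₁B w hw))
  · intro w hw
    rw [mem_support_append_iff, mem_support_append_iff, support_reverse, List.mem_reverse, support_cons, support_nil,
      List.mem_cons, List.mem_singleton] at hw
    rcases hw with hw | hw | rfl | rfl
    · exact Or.inr (Or.inl (hM''sub w hw))
    · exact Or.inl hw
    · exact K.x_mem_Z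
    · exact K.y_mem_Z

/-- **Routes exist from TAIL conditions** (`x` on the root's side): the column of `x` inside `Ω`, the column of `y` inside `Ω` if `y ∈ Ω`,
and above each of its `Ω`-vertices inside `Ω`. [cite: BalisterBollobasRiordan2014, §"bond percolation" p. 13] -/
theorem exists_routeData_of_tails {ωe : Set (Sym2 V)} {Ω : Set V} {o : V} (hωe : ωe ∉ exitEv H Ω o)
    (hx : (og H ωe).Reachable o x) (hy : y ∉ Ω ∨ ∃ q', q' ∉ Ω ∧ (og H ωe).Reachable y q')
    (hAΩ : ∀ w ∈ K.A.support, w ∈ Ω) (hBy : y ∈ Ω → ∀ w ∈ K.B.support, w ∈ Ω)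
    (hBtail : ∀ (u : V) (hu : u ∈ K.B.reverse.support), u ∈ Ω → ∀ w ∈ (K.B.reverse.dropUntil u hu).support, w ∈ Ω) :
    ∃ D : RouteData H ωe Ω K.Z o, s(D.a, D.b) ∈ E' := by
  -- the first cycle vertex seen from the root
  obtain ⟨πx⟩ := hx
  obtain ⟨u, huZ, π, -, -, hπ⟩ := exists_first_hit πx K.Z K.x_mem_Z
  have huΩ : u ∈ Ω := mem_of_reachable_of_not_exit hωe π.reachable
  -- the first cycle vertex seen from `F`
  obtain ⟨v₀, hv₀Z, hv₀, hv₀r⟩ : ∃ v₀, v₀ ∈ K.Z ∧ K.Exit ωe Ω v₀ ∧ ¬ (og H ωe).Reachable o v₀ := by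
    rcases hy with hy | ⟨q', hq', ⟨ρ'⟩⟩
    · exact ⟨y, K.y_mem_Z, Or.inl hy, fun h => hy (mem_of_reachable_of_not_exit hωe h)⟩
    · obtain ⟨v₀, hv₀Z, ρ₀, -, -, hρ₀⟩ := exists_first_hit ρ'.reverse K.Z K.y_mem_Z
      refine ⟨v₀, hv₀Z, Or.inr ⟨q', hq', ρ₀.reverse, fun w hw hZ => hρ₀ w (by simpa using hw) hZ⟩, fun h => ?_⟩
      exact hq' (mem_of_reachable_of_not_exit hωe (h.trans ρ₀.reachable.symm))
  have hv₀u : v₀ ≠ u := fun h => hv₀r (h ▸ π.reachable)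
  by_cases huA : u ∈ K.A.support
  · exact K.routeData_of_mem_A huA π hπ hv₀Z hv₀u hv₀ hAΩ
  by_cases huB : u ∈ K.B.support
  · by_cases hyΩ : y ∈ Ω
    · -- mirror: `u` lies on the column of `y`, which is inside `Ω` since `y` is
      have hBΩ' : ∀ w ∈ K.B.support, w ∈ Ω := hBy hyΩ
      have h := K.mirror.routeData_of_mem_A (ωe := ωe) (Ω := Ω) (o := o) (u := u) (v₀ := v₀) (by simpa [mirror] using huB) π
        (fun w hw hZ => hπ w hw (by rwa [K.mirror_Z] at hZ)) (by rw [K.mirror_Z]; exact hv₀Z) hv₀u (K.mirror_exit hv₀)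
        (fun w hw => hBΩ' w (by simpa [mirror] using hw))
      rwa [K.mirror_Z] at h
    · -- NEW: `y ∉ Ω` — climb the column of `y` from `u`
      have huBr : u ∈ K.B.reverse.support := by simpa using huB
      exact K.routeData_of_mem_B_of_notMem huBr hyΩ π hπ (hBtail u huBr huΩ)
  · have huM : u ∈ K.M.support := by
      rcases huZ with h | h | h
      · exact absurd h huA
      · exact h
      · exact absurd h huB
    exact K.routeData_of_mem_M huM huA huB huΩ π hπ hv₀Z hv₀u hv₀

/-- **THE LOCAL MODIFICATION EXISTS at a pivotal subgraph edge carrying a cycle kit, FROM TAIL CONDITIONS** (what an up-closed `Ω`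
supplies): the column of each endpoint inside `Ω` when the endpoint is, and the part of each column above any of its `Ω`-vertices inside `Ω`.
Replaces the class dichotomy of `exists_routeData_of_pivotal`. [cite: AizenmanGrimmett1991, §2 (essential enhancements)]
[cite: BalisterBollobasRiordan2014, §"bond percolation" p. 13] -/
theorem exists_routeData_of_pivotal_of_tails {Ω : Set V} {o : V} {ω : Set (Sym2 V)}
    (hin : insert s(x, y) ω ∈ exitEv H Ω o) (hout : ω \ {s(x, y)} ∉ exitEv H Ω o)
    (hAx : x ∈ Ω → ∀ w ∈ K.A.support, w ∈ Ω) (hBy : y ∈ Ω → ∀ w ∈ K.B.support, w ∈ Ω)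
    (hAtail : ∀ (u : V) (hu : u ∈ K.A.support), u ∈ Ω → ∀ w ∈ (K.A.dropUntil u hu).support, w ∈ Ω)
    (hBtail : ∀ (u : V) (hu : u ∈ K.B.reverse.support), u ∈ Ω → ∀ w ∈ (K.B.reverse.dropUntil u hu).support, w ∈ Ω) :
    ∃ D : RouteData H (ω \ {s(x, y)}) Ω K.Z o, s(D.a, D.b) ∈ E' := by
  obtain ⟨x₀, y₀, he, -, hreach, hfar⟩ := exists_side_of_pivotal K.hyx.symm hin hout
  have hx₀Ω : x₀ ∈ Ω := mem_of_reachable_of_not_exit hout hreach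
  rcases Sym2.eq_iff.1 he with ⟨rfl, rfl⟩ | ⟨rfl, rfl⟩
  · exact K.exists_routeData_of_tails hout hreach hfar (hAx hx₀Ω) hBy hBtail
  · have hA' : ∀ w ∈ K.mirror.A.support, w ∈ Ω := fun w hw => hBy hx₀Ω w (by simpa [mirror] using hw)
    have hB'y : y₀ ∈ Ω → ∀ w ∈ K.mirror.B.support, w ∈ Ω := fun h w hw => hAx h w (by simpa [mirror] using hw)
    have hB'tail : ∀ (u : V) (hu : u ∈ K.mirror.B.reverse.support), u ∈ Ω →
        ∀ w ∈ (K.mirror.B.reverse.dropUntil u hu).support, w ∈ Ω := by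
      show ∀ (u : V) (hu : u ∈ K.A.reverse.reverse.support), u ∈ Ω → ∀ w ∈ (K.A.reverse.reverse.dropUntil u hu).support, w ∈ Ω
      exact tails_of_eq (Walk.reverse_reverse K.A).symm hAtail
    have h := K.mirror.exists_routeData_of_tails hout hreach hfar hA' hB'y hB'tail
    rwa [K.mirror_Z] at h

end CycleKit

end SubLoc

end Summit.CriticalPhenomena.PercolationContinuityZ3.Theorems.Transplant
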